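import Summits.PneNP.PneNP.Theses.OneSlice
import Literature.Computability.Complexity.GnpSprinkling
import Literature.Computability.Complexity.Rossman2008CliqueProofs
import Literature.Computability.Complexity.CliqueTestGraphs
import Literature.Computability.Complexity.CliqueRestriction

/-!
# Negative lemmas for crux `SliceACZero` (stmt-PneNP-2835), Part VIII-B: disjoint cliques in `G(n,q)`

An elementary, second-moment-free upper bound for the probability that `G(n,q)` has NO `k`-clique:

* `sum_filter_noneFull_gnpWeight` — for vertex sets `A 0, …, A (T-1)` whose clique vectors have
  pairwise disjoint supports, the events `K_{A i} ⊆ G` are independent: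
  `Pr[∀ i < T, K_{A i} ⊈ G] = ∏_{i<T} (1 − q^{e(K_{A i})})` (induction on `T` with the in-tree
  planting identity `sum_filter_forall_gnpWeight_mul`).
* `gnpProb_cliqueFree_le_pow` — with the `⌊n/k⌋` consecutive vertex blocks of size `k`:
  `Pr_{G(n,q)}[no k-clique] ≤ (1 − q^{C(k,2)})^{⌊n/k⌋}` (`0 ≤ q ≤ 1`).

This replaces Janson/second-moment estimates whenever `⌊n/k⌋ · q^{C(k,2)} → ∞`, i.e. for densities
`q ≫ n^{-2/(k(k-1))}`; consumed by `WindowHigh.lean` (the upper edge of the window of `Conc`).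
"Block `A` is full in `x`" is written inline as `∀ e, cliqueVec A e = true → x e = true`.
Sorry-free, standard axioms; nothing here mentions a Theses decl. Refuter seat
cdisprove-stmt-PneNP-2835 (gen 2), 2026-08-16.
-/

noncomputable section

namespace Summit.PneNP.PneNP.Theorems.SliceACZero.Negative

open Literature.Computability.Complexity Finset

variable {n : ℕ}

/-- Planting a vector with support disjoint from `K_A` does not change whether `K_A` is full. [folklore] -/
theorem forall_cliqueVec_sup_iff {A B : Finset (Fin n)}
    (hdisj : ∀ e, cliqueVec A e = true → cliqueVec B e = false)
    (x : (⊤ : SimpleGraph (Fin n)).edgeSet → Bool) :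
    (∀ e, cliqueVec A e = true → (x ⊔ cliqueVec B) e = true) ↔
      (∀ e, cliqueVec A e = true → x e = true) := by
  constructor
  · intro h e he
    have := h e he
    rw [sup_apply_bool, hdisj e he, Bool.or_false] at this
    exact this
  · intro h e he
    rw [sup_apply_bool, h e he, Bool.true_or]

open Classical in
/-- **Independence of disjoint cliques**: if the clique vectors of `A 0, …, A (T-1)` have pairwise
disjoint supports then `Pr_{G(n,q)}[∀ i < T, K_{A i} ⊈ G] = ∏_{i<T} (1 − q^{e(K_{A i})})`.
Induction on `T`: `Pr[none of T+1] = Pr[none of T] − Pr[none of T ∧ K_{A T} ⊆ G]`, and by the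
planting identity the last term is `q^{e(K_{A T})} · Pr[none of T]` (planting `K_{A T}` does not
touch the other blocks). Valid for every real `q`. [folklore] -/
theorem sum_filter_noneFull_gnpWeight (q : ℝ) (A : ℕ → Finset (Fin n))
    (hdisj : ∀ i j, i ≠ j → ∀ e, cliqueVec (A i) e = true → cliqueVec (A j) e = false) :
    ∀ T : ℕ, ∑ x ∈ univ.filter (fun x : (⊤ : SimpleGraph (Fin n)).edgeSet → Bool =>
        ∀ i < T, ¬ ∀ e, cliqueVec (A i) e = true → x e = true), gnpWeight n q x =
      ∏ i ∈ range T, (1 - q ^ edgeCount (cliqueVec (A i))) := by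
  intro T
  induction T with
  | zero =>
    rw [Finset.prod_range_zero, Finset.filter_true_of_mem]
    · exact sum_gnpWeight q
    · intro x _ i hi
      exact absurd hi (Nat.not_lt_zero i)
  | succ T ih =>
    -- abbreviations
    set P : ((⊤ : SimpleGraph (Fin n)).edgeSet → Bool) → Prop := fun x =>
      ∀ i < T, ¬ ∀ e, cliqueVec (A i) e = true → x e = true with hP
    set F : ((⊤ : SimpleGraph (Fin n)).edgeSet → Bool) → Prop := fun x =>
      ∀ e, cliqueVec (A T) e = true → x e = true with hF
    have hP1 : ∀ x : (⊤ : SimpleGraph (Fin n)).edgeSet → Bool,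
        (∀ i < T + 1, ¬ ∀ e, cliqueVec (A i) e = true → x e = true) ↔ (P x ∧ ¬ F x) := by
      intro x
      constructor
      · intro h
        exact ⟨fun i hi => h i (Nat.lt_succ_of_lt hi), h T (Nat.lt_succ_self T)⟩
      · rintro ⟨h1, h2⟩ i hi
        rcases Nat.lt_succ_iff_lt_or_eq.1 hi with hi' | rfl
        · exact h1 i hi'
        · exact h2
    have hfilt : (univ.filter fun x : (⊤ : SimpleGraph (Fin n)).edgeSet → Bool =>
        ∀ i < T + 1, ¬ ∀ e, cliqueVec (A i) e = true → x e = true) =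
        univ.filter fun x => P x ∧ ¬ F x := by
      ext x
      simp only [Finset.mem_filter, Finset.mem_univ, true_and]
      exact hP1 x
    -- split the event `none of T+1` as `none of T` minus `none of T and block T full`
    have hsplit : ∑ x ∈ univ.filter (fun x => P x ∧ ¬ F x), gnpWeight n q x =
        ∑ x ∈ univ.filter (fun x => P x), gnpWeight n q x -
          ∑ x ∈ univ.filter (fun x => P x ∧ F x), gnpWeight n q x := by
      have hunion : (univ.filter fun x : (⊤ : SimpleGraph (Fin n)).edgeSet → Bool => P x) =
          (univ.filter fun x => P x ∧ ¬ F x) ∪ (univ.filter fun x => P x ∧ F x) := by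
        ext x
        simp only [Finset.mem_union, Finset.mem_filter, Finset.mem_univ, true_and]
        tauto
      have hdis : Disjoint (univ.filter fun x : (⊤ : SimpleGraph (Fin n)).edgeSet → Bool => P x ∧ ¬ F x)
          (univ.filter fun x => P x ∧ F x) := by
        rw [Finset.disjoint_filter]
        rintro x - ⟨-, h⟩ ⟨-, h'⟩
        exact h h'
      rw [hunion, Finset.sum_union hdis]
      ring
    -- the subtracted term, by planting
    have hplant : ∑ x ∈ univ.filter (fun x => P x ∧ F x), gnpWeight n q x =
        q ^ edgeCount (cliqueVec (A T)) * ∑ x ∈ univ.filter (fun x => P x), gnpWeight n q x := by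
      have h := sum_filter_forall_gnpWeight_mul q (cliqueVec (A T)) (fun x => if P x then (1 : ℝ) else 0)
      -- left side of `h` is our subtracted term
      have hL : ∑ x ∈ univ.filter (fun x : (⊤ : SimpleGraph (Fin n)).edgeSet → Bool =>
            ∀ e, cliqueVec (A T) e = true → x e = true),
            gnpWeight n q x * (if P x then (1 : ℝ) else 0) =
          ∑ x ∈ univ.filter (fun x => P x ∧ F x), gnpWeight n q x := by
        rw [Finset.sum_filter, Finset.sum_filter]
        refine Finset.sum_congr rfl fun x _ => ?_
        change (if F x then gnpWeight n q x * (if P x then (1 : ℝ) else 0) else 0) = _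
        by_cases h1 : F x <;> by_cases h2 : P x <;> simp [h1, h2]
      -- right side: planting block `T` does not change `P`
      have hR : ∑ x, gnpWeight n q x * (if P (x ⊔ cliqueVec (A T)) then (1 : ℝ) else 0) =
          ∑ x ∈ univ.filter (fun x => P x), gnpWeight n q x := by
        rw [Finset.sum_filter]
        refine Finset.sum_congr rfl fun x _ => ?_
        have hiff : P (x ⊔ cliqueVec (A T)) ↔ P x := by
          refine forall₂_congr fun i hi => ?_
          rw [forall_cliqueVec_sup_iff (fun e he => hdisj i T (Nat.ne_of_lt hi) e he)]
        by_cases h2 : P x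
        · rw [if_pos (hiff.2 h2), if_pos h2, mul_one]
        · rw [if_neg (fun h' => h2 (hiff.1 h')), if_neg h2, mul_zero]
      rw [← hL, h, hR]
    rw [hfilt, hsplit, hplant, ih, Finset.prod_range_succ]
    ring

/-! ### Consecutive vertex blocks of size `k` -/

/-- The `i`-th block of `k` consecutive vertices `{ik, …, ik + k − 1}` (as a subset of `Fin n`).
[folklore] -/
def block (n k i : ℕ) : Finset (Fin n) := univ.filter fun v => i * k ≤ v.val ∧ v.val < i * k + k

/-- A block inside `[0, n)` has exactly `k` vertices. [folklore] -/
theorem card_block {k i : ℕ} (h : i * k + k ≤ n) : #(block n k i) = k := by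
  have himage : (block n k i).image Fin.val = Finset.Ico (i * k) (i * k + k) := by
    ext m
    simp only [block, Finset.mem_image, Finset.mem_filter, Finset.mem_univ, true_and, Finset.mem_Ico]
    constructor
    · rintro ⟨v, ⟨h1, h2⟩, rfl⟩
      exact ⟨h1, h2⟩
    · rintro ⟨h1, h2⟩
      exact ⟨⟨m, by omega⟩, ⟨h1, h2⟩, rfl⟩
  rw [← Finset.card_image_of_injective _ Fin.val_injective, himage, Nat.card_Ico]
  omega

/-- Distinct blocks are vertex-disjoint. [folklore] -/
theorem eq_of_mem_block {k i j : ℕ} {v : Fin n} (hi : v ∈ block n k i) (hj : v ∈ block n k j) :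
    i = j := by
  simp only [block, Finset.mem_filter, Finset.mem_univ, true_and] at hi hj
  by_contra hne
  rcases lt_or_gt_of_ne hne with h | h
  · have h' : (i + 1) * k ≤ j * k := Nat.mul_le_mul_right k h
    rw [Nat.add_mul, one_mul] at h'
    omega
  · have h' : (j + 1) * k ≤ i * k := Nat.mul_le_mul_right k h
    rw [Nat.add_mul, one_mul] at h'
    omega

/-- The clique vectors of distinct blocks have disjoint supports. [folklore] -/
theorem cliqueVec_block_disjoint {k : ℕ} (i j : ℕ) (hij : i ≠ j)
    (e : (⊤ : SimpleGraph (Fin n)).edgeSet) (he : cliqueVec (block n k i) e = true) :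
    cliqueVec (block n k j) e = false := by
  obtain ⟨e, hemem⟩ := e
  induction e using Sym2.ind with
  | _ u v =>
    rw [cliqueVec_mk] at he ⊢
    rw [decide_eq_true_eq] at he
    rw [decide_eq_false_iff_not]
    rintro ⟨hu, -⟩
    exact hij (eq_of_mem_block he.1 hu)

/-- Blocks with index `< ⌊n/k⌋` fit inside `[0, n)`. [folklore] -/
theorem block_fits {k i : ℕ} (hi : i < n / k) : i * k + k ≤ n := by
  have h1 : (i + 1) * k ≤ (n / k) * k := Nat.mul_le_mul_right k hi
  have h2 : (n / k) * k ≤ n := Nat.div_mul_le_self n k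
  rw [Nat.add_mul, one_mul] at h1
  omega

open Classical in
/-- **`Pr_{G(n,q)}[no k-clique] ≤ (1 − q^{C(k,2)})^{⌊n/k⌋}`** (`0 ≤ q ≤ 1`): a clique-free graph fills
none of the `⌊n/k⌋` disjoint `k`-blocks, and these events are independent. [folklore] -/
theorem gnpProb_cliqueFree_le_pow (k : ℕ) {q : ℝ} (hq0 : 0 ≤ q) (hq1 : q ≤ 1) :
    ∑ x ∈ univ.filter (fun x : (⊤ : SimpleGraph (Fin n)).edgeSet → Bool => cliqueFn n k x = false),
        gnpWeight n q x ≤ (1 - q ^ k.choose 2) ^ (n / k) := by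
  rcases Nat.eq_zero_or_pos k with rfl | hk
  · simp only [Nat.choose_zero_succ, pow_zero, sub_self, Nat.div_zero]
    calc ∑ x ∈ univ.filter (fun x : (⊤ : SimpleGraph (Fin n)).edgeSet → Bool => cliqueFn n 0 x = false),
          gnpWeight n q x ≤ ∑ x, gnpWeight n q x :=
          Finset.sum_le_sum_of_subset_of_nonneg (Finset.filter_subset _ _)
            fun x _ _ => gnpWeight_nonneg hq0 hq1 x
      _ = 1 := sum_gnpWeight q
  set T := n / k with hT
  -- clique-free graphs fill no block
  have hsub : (univ.filter fun x : (⊤ : SimpleGraph (Fin n)).edgeSet → Bool => cliqueFn n k x = false) ⊆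
      univ.filter fun x => ∀ i < T, ¬ ∀ e, cliqueVec (block n k i) e = true → x e = true := by
    intro x hx
    rw [Finset.mem_filter] at hx ⊢
    refine ⟨Finset.mem_univ _, fun i hi hfull => ?_⟩
    have hcard : #(block n k i) = k := card_block (block_fits hi)
    have hle : cliqueVec (block n k i) ≤ x := fun e => by
      cases hce : cliqueVec (block n k i) e
      · exact Bool.false_le _
      · rw [hfull e hce]
    have hmono := cliqueFn_monotone_holds n k hle
    rw [cliqueFn_cliqueVec (le_of_eq hcard.symm), hx.2] at hmono
    exact absurd hmono (by decide)
  refine (Finset.sum_le_sum_of_subset_of_nonneg hsub fun x _ _ => gnpWeight_nonneg hq0 hq1 x).trans ?_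
  rw [sum_filter_noneFull_gnpWeight q (block n k) (fun i j hij => cliqueVec_block_disjoint i j hij) T]
  -- every factor with `i < T` equals `1 - q^{C(k,2)}`
  have hfac : ∀ i ∈ range T, (1 - q ^ edgeCount (cliqueVec (block n k i))) = 1 - q ^ k.choose 2 := by
    intro i hi
    rw [Finset.mem_range] at hi
    rw [edgeCount, card_filter_cliqueVec, card_block (block_fits hi)]
  rw [Finset.prod_congr rfl hfac, Finset.prod_const, Finset.card_range]

end Summit.PneNP.PneNP.Theorems.SliceACZero.Negative

end
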